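import Mathlib
import Summits.Ventures.HodgeRepro.Tier4.Line1.GeneratedSubspace

/-!
# Tier4/Line1/BlockSimple — (C1) SIMPLICITY OF A FINITE BLOCK FROM TOPOLOGICAL IRREDUCIBILITY: a non-zero subspace of
the block that is stable under `e ∘ R(f)` for every test function `f` is the whole block

Blind re-derivation cell `pub-hodge-repro`, Tier 4 (README §9–§10), seat t4-L1-p2 (gen 4), LINE L1.  Target tree path
`lean/Summits/Ventures/HodgeRepro/Tier4/Line1/BlockSimple.lean`.  Imports this seat's `GeneratedSubspace` (the
composition law, `generated`, `isInvariantSubspace_generated`, `e_generated_mem`, `inner_add_left_pi`, `toLpOn`) and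
through it t4-L1-p4's `RelClosed` (`inner_eq_L2`, `norm_inner_le`) and `InnerCalculus` (`eq_of_ae_eq_DG`).  0 print.

WHAT THIS IS.  L1's (S3″) Hecke isolation (t4-L1-p5's `HeckeBlockW`, HeckeBlockWeak p68xxxx) DISPLAYS (C1): every
constituent `(τ m) ∩ Vb` of the finite block is a SIMPLE module over the Hecke algebra `H` — «admissibility theory»,
the named obstruction of the census (t4-L1-p1 S13560: (C1)–(C3)).  This file proves the content of (C1) from the
tree's own notion of irreducibility (`IsIrreducible`: every invariant subspace of `τ m` is zero or `L²(DG)`-dense in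
it) — the classical «`eV` is simple over `eAe` when `V` is simple over `A`» with TOPOLOGICAL irreducibility in place of
algebraic, which a FINITE-dimensional block absorbs:

* `mem_of_forall_inner_eq_zero` — the Hilbert-space step: a vector of a finite-dimensional block orthogonal to everything
  orthogonal to `N` lies in `N` (the classes of `N` in `L²(DG)` form a finite-dimensional, hence complete, subspace;
  `starProjection`; a.e. rigidity `eq_of_ae_eq_DG`);
* THEOREM **`eq_of_block_irreducible`**: `V` invariant and irreducible; `e` a map with `e V ⊆ V`, linear on `V`,
  self-adjoint for `S.inner` on `V`; `W` a finite-dimensional submodule of functions inside `V` fixed by `e`; `N ≤ W` a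
  submodule with `N ≠ ⊥`, stable under `e ∘ R(f)` for every test `f` (`hNR`), and not killed by every `R(f)` (`hR`).
  Then `N = W`.  Proof: `V' := generated N` is a non-zero invariant subspace of `V`, hence `L²(DG)`-dense in `V`
  (`hirr`); for `z ∈ W` orthogonal to `N` and `u ∈ V'`: `⟪u, z⟫ = ⟪u, e z⟫ = ⟪e u, z⟫ = 0` (`e u ∈ N` by `hNR` and
  linearity — `e_generated_mem`), so for `v ∈ W`, `‖⟪v, z⟫‖ = ‖⟪v − u, z⟫‖ ≤ ‖z‖₂ ‖v − u‖₂` is arbitrarily small: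
  `⟪v, z⟫ = 0` (`inner_eq_zero_of_orthogonal`); in the Hilbert space `L²(DG)` the classes of `N` form a
  finite-dimensional, hence closed, subspace `N'`, the component of `v`'s class orthogonal to `N'` is the class of some
  `z ∈ W` orthogonal to `N`, and `⟪v, z⟫ = 0` forces it to vanish — so the class of `v` lies in `N'`, i.e. `v` agrees
  a.e. on `DG` with some `n ∈ N`, hence everywhere (`eq_of_ae_eq_DG`).

CONSUMER (for p5's `HeckeBlock.simple`, plan-1 S13957 (i)): with `Vb` the block, `H` the Hecke algebra acting by
`hact`, `e` the level idempotent and the DISPLAYED clause «`e A e = H`» — `hfull : ∀ f, IsTest f → ∃ r : H, ∀ ψ ∈ Vb,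
e (R f ψ) = R (tst r) ψ` (on the spherical instance `r = indK ⋆ f ⋆ indK`, the spherical Hecke algebra of level `K`;
displayed, derived nowhere) — every `H`-submodule of a constituent is stable under `e ∘ R(f)`, so (C1)
`IsSimpleModule H (W i)` follows from this theorem and p5's `he_*` fields (`hR` from `he_id` with `f = indK`): (C1) is a
THEOREM for the spherical block modulo `hfull`.  (C2) is not touched; record precision (plan-1 S13957 (ii)): «pairwise
non-isomorphic constituents» is multiplicity one of `L²(Gk\G)` for the block — the honest (C2) is about ISOTYPIC
components.  Scope: spherical = trivial archimedean type on a totally definite plane.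

JUNK TESTS.  `N = ⊥`: excluded by `hN0` (the conclusion would be false).  `W = ⊥`: then `N = ⊥`, excluded.  `e = id`,
`W = V` finite-dimensional: the statement is «a non-zero `A`-submodule of an irreducible finite-dimensional `V` is `V`» —
the algebraic case.  `e = 0`: `hWe` forces `W = ⊥`, excluded.  No hypothesis is vacuous on p5's spherical instance
(`e = R(indK)`, `W = (τ m) ∩ sphericalBlock`, finite-dimensional by p1's LevelBlockFinite).

NOT claimed: (C2), the dictionary `tf`, (S1a), `P_T4`.  Nothing here says anything about the status of the Hodge
conjecture for CM abelian varieties, which is NOT proved (HC_CM is NOT proved by anyone in this repository).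
-/

set_option autoImplicit false

noncomputable section

namespace Summit.Ventures.HodgeRepro.Tier4.Line1

open MeasureTheory Topology
open scoped ComplexConjugate

namespace RTF

namespace Setting

variable {G : Type} [Group G] [TopologicalSpace G] [IsTopologicalGroup G] [MeasurableSpace G] [BorelSpace G]
  (S : Setting G)

section FiniteBlock

/-- **a vector of a finite-dimensional block orthogonal to everything orthogonal to `N` lies in `N`** (the Hilbert-space
step in `L²(DG)`: the classes of `N` form a finite-dimensional, hence complete, subspace; the component of `v` orthogonal
to it is the class of a `z ∈ W` orthogonal to `N`; `⟪v, z⟫ = 0` forces it to vanish; a.e. rigidity `eq_of_ae_eq_DG`). -/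
theorem mem_of_forall_inner_eq_zero [Countable S.Gk] {V : Set (G → ℂ)} (hV : S.IsInvariantSubspace V)
    (W : Submodule ℂ (G → ℂ)) [FiniteDimensional ℂ W] (hWV : (W : Set (G → ℂ)) ⊆ V)
    (N : Submodule ℂ (G → ℂ)) (hNW : N ≤ W) {v : G → ℂ} (hv : v ∈ W)
    (horth : ∀ z ∈ W, (∀ n ∈ N, S.inner n z = 0) → S.inner v z = 0) : v ∈ N := by
  have hcW : ∀ ψ ∈ W, Continuous ψ := fun ψ hψ => hV.cont ψ (hWV hψ)
  set T := S.toLpOn W hcW with hT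
  set N' : Submodule ℂ (Lp ℂ 2 (S.μ.restrict S.DG)) := (N.comap W.subtype).map T with hN'
  haveI : FiniteDimensional ℂ N' := Module.Finite.map _ _
  haveI : CompleteSpace N' := FiniteDimensional.complete ℂ N'
  set v' := T ⟨v, hv⟩ with hv'
  have hp : N'.starProjection v' ∈ N' := N'.starProjection_apply_mem v'
  have hq : v' - N'.starProjection v' ∈ N'ᗮ := N'.sub_starProjection_mem_orthogonal v'
  obtain ⟨n₀, hn₀, hn₀eq⟩ := Submodule.mem_map.1 hp
  -- the orthogonal component is the class of `z := v - n₀ ∈ W`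
  set z' : W := ⟨v, hv⟩ - n₀ with hz'
  have hqz : v' - N'.starProjection v' = T z' := by
    rw [hz', map_sub, ← hn₀eq]
  -- `z` is orthogonal to `N`
  have hzN : ∀ n ∈ N, S.inner n (z' : G → ℂ) = 0 := by
    intro n hn
    rw [S.inner_eq_L2 (hV.cont n (hWV (hNW hn))) (hcW _ z'.2)]
    have h1 : (S.memLp_two_DG (hcW _ z'.2)).toLp (z' : G → ℂ) = T z' := rfl
    have h2 : (S.memLp_two_DG (hV.cont n (hWV (hNW hn)))).toLp n = T ⟨n, hNW hn⟩ := rfl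
    rw [h1, h2, ← hqz]
    refine Submodule.inner_left_of_mem_orthogonal (K := N') ?_ hq
    exact Submodule.mem_map.2 ⟨⟨n, hNW hn⟩, hn, rfl⟩
  -- `⟪v, z⟫ = 0` and `⟪p, z⟫ = 0`, so the component vanishes
  have hvz : Inner.inner ℂ (T z') v' = 0 := by
    have := horth _ z'.2 hzN
    rw [S.inner_eq_L2 (hcW v hv) (hcW _ z'.2)] at this
    exact this
  have hpz : Inner.inner ℂ (T z') (N'.starProjection v') = 0 := by
    rw [← hqz]
    exact Submodule.inner_left_of_mem_orthogonal hp hq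
  have hzz : Inner.inner ℂ (T z') (T z') = 0 := by
    rw [← hqz, inner_sub_right, hqz, hvz, hpz, sub_zero]
  have hz0 : T z' = 0 := inner_self_eq_zero.1 hzz
  -- hence the class of `v` is the class of `n₀ ∈ N`, and `v = n₀` by a.e. rigidity
  have hvn : T ⟨v, hv⟩ = T n₀ := by
    have : T (⟨v, hv⟩ - n₀) = 0 := hz0
    rw [map_sub, sub_eq_zero] at this
    exact this
  have hae : (v : G → ℂ) =ᵐ[S.μ.restrict S.DG] (n₀ : G → ℂ) := by
    have h1 := S.toLpOn_coeFn W hcW ⟨v, hv⟩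
    have h2 := S.toLpOn_coeFn W hcW n₀
    rw [hvn] at h1
    exact h1.symm.trans h2
  have hveq : v = (n₀ : G → ℂ) :=
    S.eq_of_ae_eq_DG (hV.inv v (hWV hv)) (hcW v hv) (hV.inv _ (hWV n₀.2)) (hcW _ n₀.2) hae
  rw [hveq]
  exact hn₀

end FiniteBlock

section Main

/-- **(C1) SIMPLICITY OF A FINITE BLOCK FROM TOPOLOGICAL IRREDUCIBILITY** (the theorem of record of this file): `V`
invariant and irreducible; `e : (G → ℂ) → (G → ℂ)` mapping `V` to itself, linear on `V` and self-adjoint for `S.inner`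
on `V`; `W` a finite-dimensional submodule inside `V` fixed by `e`; `N ≤ W` a submodule stable under `e ∘ R(f)` for
every test function `f` and not killed by every `R(f)`.  Then `N = W`. -/
theorem eq_of_block_irreducible [SecondCountableTopology G] [T2Space G] [MeasurableMul G] [SFinite S.μ]
    [Countable S.Gk] {V : Set (G → ℂ)} (hV : S.IsInvariantSubspace V) (hirr : S.IsIrreducible V)
    (e : (G → ℂ) → (G → ℂ)) (he_add : ∀ ψ ∈ V, ∀ φ ∈ V, e (ψ + φ) = e ψ + e φ)
    (he_smul : ∀ ψ ∈ V, ∀ c : ℂ, e (c • ψ) = c • e ψ)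
    (he_adj : ∀ ψ ∈ V, ∀ φ ∈ V, S.inner (e ψ) φ = S.inner ψ (e φ))
    (W : Submodule ℂ (G → ℂ)) [FiniteDimensional ℂ W] (hWV : (W : Set (G → ℂ)) ⊆ V) (hWe : ∀ w ∈ W, e w = w)
    (N : Submodule ℂ (G → ℂ)) (hNW : N ≤ W) (hNR : ∀ f, IsTest f → ∀ n ∈ N, e (S.R f n) ∈ N)
    (hR : ∃ n ∈ N, ∃ f, IsTest f ∧ S.R f n ≠ 0) : N = W := by
  have hNV : (N : Set (G → ℂ)) ⊆ V := fun n hn => hWV (hNW hn)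
  have hV' := S.isInvariantSubspace_generated hV hNV
  have hsub := S.generated_subset hV hNV
  rcases hirr _ hV' hsub with hzero | hdense
  · -- the generated subspace is not zero
    exfalso
    obtain ⟨n, hn, f, hf, hne⟩ := hR
    exact hne (funext fun x => hzero _ (S.R_mem_generated hf hn) x)
  · refine le_antisymm hNW fun v hv => ?_
    refine S.mem_of_forall_inner_eq_zero hV W hWV N hNW hv fun z hz hzN => ?_
    -- every `u` in the generated subspace is orthogonal to `z`
    have hu0 : ∀ u ∈ S.generated N, S.inner u z = 0 := by
      intro u hu
      have h1 : S.inner u z = S.inner u (e z) := by rw [hWe z hz]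
      rw [h1, ← he_adj u (hsub hu) z (hWV hz)]
      exact hzN _ (S.e_generated_mem hV hNV e he_add he_smul hNR u hu)
    -- `‖⟪v, z⟫‖ ≤ ‖z‖₂ · ε` for every `ε`
    set C : ℝ := ‖(S.memLp_two_DG (hV.cont z (hWV hz))).toLp z‖ with hC
    have hC0 : 0 ≤ C := norm_nonneg _
    have hbound : ∀ ε : ℝ, 0 < ε → ‖S.inner v z‖ ≤ C * ε := by
      intro ε hε
      obtain ⟨u, hu, hεu⟩ := hdense v (hWV hv) ε hε
      have hvc := hV.cont v (hWV hv)
      have huc := hV.cont u (hsub hu)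
      have hzc := hV.cont z (hWV hz)
      have hsplit : S.inner v z = S.inner (v - u) z + S.inner u z := by
        rw [← S.inner_add_left_pi (hvc.sub huc) huc hzc, sub_add_cancel]
      rw [hsplit, hu0 u hu, add_zero]
      calc ‖S.inner (v - u) z‖
          ≤ ‖(S.memLp_two_DG (hvc.sub huc)).toLp (v - u)‖ * ‖(S.memLp_two_DG hzc).toLp z‖ :=
            S.norm_inner_le (hvc.sub huc) hzc
        _ = C * ‖(S.memLp_two_DG (hvc.sub huc)).toLp (v - u)‖ := mul_comm _ _
        _ ≤ C * ε := by
            refine mul_le_mul_of_nonneg_left ?_ hC0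
            rw [Lp.norm_toLp]
            exact ENNReal.toReal_le_of_le_ofReal hε.le hεu.le
    -- hence `⟪v, z⟫ = 0`
    by_contra hne
    have hpos : 0 < ‖S.inner v z‖ := norm_pos_iff.2 hne
    have hε : 0 < ‖S.inner v z‖ / (2 * (C + 1)) := by positivity
    have h := hbound _ hε
    have hlt : C * (‖S.inner v z‖ / (2 * (C + 1))) < ‖S.inner v z‖ := by
      rw [mul_div_assoc', div_lt_iff₀ (by positivity)]
      nlinarith
    exact absurd (lt_of_le_of_lt h hlt) (lt_irrefl _)

end Main

section Consumer

/-- **(C1) IN p5's BLOCK SHAPE** (`HeckeBlock`'s `simple` field, plan-1 S13957 (i)): `Vb` a finite-dimensional block of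
functions with an `H`-module structure given by the right-regular action of the test functions `tst r` (`hact`), `Wi` the
`H`-submodule `τ m' ∩ Vb` of an invariant irreducible `τ m'`, `e` the level idempotent (linear on `τ m'`, self-adjoint,
`e ψ ∈ Vb` for `ψ ∈ τ m'`, the identity on `Vb`), the DISPLAYED clause `hfull` («`e A e = H`»: every `e ∘ R(f)` on the block
is some `R(tst r)`), a test function acting as the identity on the block (`he_test`; `indK` on the spherical instance)
and a non-zero vector in `Wi`.  Then `Wi` is a simple `H`-module.  (`R_R_eq_R_conv_conv` below shows `hfull` holds for
`H = C_c(K\G/K)` with `e = R(indK)`: `e (R f ψ) = R (indK ⋆ f ⋆ indK) ψ`.) -/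
theorem isSimpleModule_of_block [SecondCountableTopology G] [T2Space G] [MeasurableMul G] [SFinite S.μ]
    [Countable S.Gk] {τ : ℕ → Set (G → ℂ)} (m' : ℕ) (hinv : S.IsInvariantSubspace (τ m'))
    (hirr : S.IsIrreducible (τ m')) {H : Type} [Ring H] [Algebra ℂ H] {Vb : Submodule ℂ (G → ℂ)}
    [FiniteDimensional ℂ Vb] [Module H Vb] [IsScalarTower ℂ H Vb] (tst : H → (G → ℂ))
    (hact : ∀ (r : H) (ψ : Vb), ((r • ψ : Vb) : G → ℂ) = S.R (tst r) ψ) (Wi : Submodule H Vb)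
    (hWi : ∀ ψ : Vb, ψ ∈ Wi ↔ (ψ : G → ℂ) ∈ τ m') (e : (G → ℂ) → (G → ℂ))
    (he_add : ∀ ψ ∈ τ m', ∀ φ ∈ τ m', e (ψ + φ) = e ψ + e φ) (he_smul : ∀ ψ ∈ τ m', ∀ c : ℂ, e (c • ψ) = c • e ψ)
    (he_adj : ∀ ψ ∈ τ m', ∀ φ ∈ τ m', S.inner (e ψ) φ = S.inner ψ (e φ)) (he_id : ∀ v ∈ Vb, e v = v)
    (hfull : ∀ f, IsTest f → ∃ r : H, ∀ ψ ∈ Vb, e (S.R f ψ) = S.R (tst r) ψ)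
    (he_test : ∃ f₀, IsTest f₀ ∧ ∀ v ∈ Vb, S.R f₀ v = v) (hne : ∃ w : Vb, w ∈ Wi ∧ w ≠ 0) :
    IsSimpleModule H Wi := by
  classical
  -- `Wi` and its `H`-submodules as `ℂ`-submodules of functions
  let toFun : Submodule H Vb → Submodule ℂ (G → ℂ) := fun M =>
    (M.restrictScalars ℂ).map ((Vb.subtype : Vb →ₗ[ℂ] (G → ℂ)))
  have hmem : ∀ (M : Submodule H Vb) (ψ : G → ℂ), ψ ∈ toFun M ↔ ∃ w : Vb, w ∈ M ∧ (w : G → ℂ) = ψ := by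
    intro M ψ
    simp only [toFun, Submodule.mem_map, Submodule.restrictScalars_mem, Submodule.subtype_apply]
  haveI : FiniteDimensional ℂ (toFun Wi) := Module.Finite.map _ _
  have hWV : (toFun Wi : Set (G → ℂ)) ⊆ τ m' := by
    intro ψ hψ
    obtain ⟨w, hw, rfl⟩ := (hmem Wi ψ).1 hψ
    exact (hWi w).1 hw
  have hWe : ∀ w ∈ toFun Wi, e w = w := by
    intro ψ hψ
    obtain ⟨w, _, rfl⟩ := (hmem Wi ψ).1 hψ
    exact he_id _ w.2
  obtain ⟨w₀, hw₀, hw₀ne⟩ := hne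
  have hbt : (⊥ : Submodule H Wi) ≠ ⊤ := by
    intro h
    have : (⟨w₀, hw₀⟩ : Wi) ∈ (⊤ : Submodule H Wi) := Submodule.mem_top
    rw [← h, Submodule.mem_bot] at this
    exact hw₀ne (congrArg Subtype.val this)
  haveI : Nontrivial (Submodule H Wi) := ⟨⟨⊥, ⊤, hbt⟩⟩
  have hsimple : ∀ M : Submodule H Wi, M = ⊥ ∨ M = ⊤ := fun M => by
    by_cases hM : M = ⊥
    · exact Or.inl hM
    right
    -- the `ℂ`-submodule of functions `N` carried by `M`
    let N : Submodule ℂ (G → ℂ) := toFun (M.map Wi.subtype)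
    have hNmem : ∀ ψ : G → ℂ, ψ ∈ N ↔ ∃ w : Wi, w ∈ M ∧ ((w : Vb) : G → ℂ) = ψ := by
      intro ψ
      rw [hmem]
      constructor
      · rintro ⟨v, hv, rfl⟩
        obtain ⟨w, hw, rfl⟩ := Submodule.mem_map.1 hv
        exact ⟨w, hw, rfl⟩
      · rintro ⟨w, hw, rfl⟩
        exact ⟨w, Submodule.mem_map.2 ⟨w, hw, rfl⟩, rfl⟩
    have hNW : N ≤ toFun Wi := by
      intro ψ hψ
      obtain ⟨w, _, rfl⟩ := (hNmem ψ).1 hψ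
      exact (hmem Wi _).2 ⟨w, w.2, rfl⟩
    -- `N` is stable under `e ∘ R(f)` (the displayed `hfull`)
    have hNR : ∀ f, IsTest f → ∀ n ∈ N, e (S.R f n) ∈ N := by
      intro f hf n hn
      obtain ⟨w, hw, rfl⟩ := (hNmem n).1 hn
      obtain ⟨r, hr⟩ := hfull f hf
      rw [hr _ (w : Vb).2, ← hact r (w : Vb)]
      refine (hNmem _).2 ⟨r • w, M.smul_mem r hw, ?_⟩
      rfl
    -- `N` is not killed by every `R(f)`
    have hR : ∃ n ∈ N, ∃ f, IsTest f ∧ S.R f n ≠ 0 := by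
      obtain ⟨w, hw, hwne⟩ := (Submodule.ne_bot_iff M).1 hM
      obtain ⟨f₀, hf₀, hf₀id⟩ := he_test
      refine ⟨_, (hNmem _).2 ⟨w, hw, rfl⟩, f₀, hf₀, ?_⟩
      rw [hf₀id _ (w : Vb).2]
      intro h0
      apply hwne
      apply Subtype.ext
      apply Subtype.ext
      exact h0
    have hNeq : N = toFun Wi :=
      S.eq_of_block_irreducible hinv hirr e he_add he_smul he_adj (toFun Wi) hWV hWe N hNW hNR hR
    -- hence `M = ⊤`
    refine eq_top_iff.2 fun w _ => ?_
    have hw : ((w : Vb) : G → ℂ) ∈ N := by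
      rw [hNeq]
      exact (hmem Wi _).2 ⟨w, w.2, rfl⟩
    obtain ⟨w', hw', hw'eq⟩ := (hNmem _).1 hw
    have : w' = w := by
      apply Subtype.ext
      apply Subtype.ext
      exact hw'eq
    rw [← this]
    exact hw'
  haveI : IsSimpleOrder (Submodule H Wi) := ⟨hsimple⟩
  exact ⟨⟩


/-- **`hfull` is a THEOREM for `H = C_c(K\G/K)`** (crit-2 S13974): for the idempotent `e := R(k)` of a test function
`k` and a `ψ` fixed by it, `e (R(f) ψ) = R(k ⋆ f ⋆ k) ψ` — two applications of the composition law; on the spherical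
instance `k = indK`, so every `e ∘ R(f)` on the block is the action of the bi-`K`-invariant test function
`indK ⋆ f ⋆ indK`. -/
theorem R_R_eq_R_conv_conv [SecondCountableTopology G] [T2Space G] [MeasurableMul G] [SFinite S.μ]
    {k f ψ : G → ℂ} (hk : IsTest k) (hf : IsTest f) (hψ : Continuous ψ) (hfix : S.R k ψ = ψ) :
    S.R k (S.R f ψ) = S.R (S.conv (S.conv k f) k) ψ := by
  rw [S.R_R_eq_R_conv hk hf hψ]
  conv_lhs => rw [← hfix]
  exact S.R_R_eq_R_conv (S.conv_isTest hk hf).1 hk hψ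

end Consumer

end Setting

end RTF

end Summit.Ventures.HodgeRepro.Tier4.Line1

end
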